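import Mathlib
import HarnessLib
import Summits.Ventures.LatticeQCDFlow.Exactness.LocationCouplingMask
import Summits.Ventures.LatticeQCDFlow.Exactness.KernelCouplingTranslation

/-!
# LOCATION couplings under lattice translations: the behind-plaquette kernel layer intertwines translations, and the engine's location masks shift their phase by `φ(t)`

HONEST FRAMING: exact (Metropolis-corrected) sampling algorithms for lattice gauge theory;
figures of merit are autocorrelation/cost numbers at stated couplings and volumes; no
continuum-physics claim.

Venture `LatticeQCDFlow` (cell pub-lqcd), topic `Exactness`; FANOUT row 10 (`eng-equiv`, engine
`latflow.equiv` v0.3 `masks.py` LOCATION couplings — "the active link is updated through the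
plaquette BEHIND it", presets `loc-checker` / `alternate`; Abbott et al. arXiv:2305.02402 §4.1.2,
named only).  NEW WORK of the cell: the item listed as "NOT here: location / alternate geometries"
in `KernelCouplingTranslation`, over `LocationCouplingMask` (the behind-plaquette kernel layer and the
location masks `p (x, μ') ↔ φ x = c ∧ μ' ∈ M`).  Nothing is cited as a fact; no number; no definition.

* `behindLoop_siteTranslate` — the behind loop `V(x,μ) V(x−ν̂+μ̂,ν)⁻¹ V(x−ν̂,μ)⁻¹ V(x−ν̂,ν)` of the
  translated configuration `V·t` at `(x, μ)` is the behind loop of `V` at `(x + t, μ)` (plane choice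
  `t`-periodic);
* **`behindPlaquetteKernelLayer_siteTranslate`** — the behind-plaquette kernel coupling layer of
  `isGaugeEquivariant_behindPlaquetteKernelLayer` (any group; masks related by `p e ↔ p' (e + t)`,
  kernel data translation covariant on active links) applied to `V·t` is the translate of the
  `p'`-layer applied to `V` (`kernelLayer_siteTranslate` with the behind loop as loop field);
  `behindPlaquetteKernelLayer_siteTranslate_of_invariant_mask` — `F (V·t) = (F V)·t` for a
  mask-preserving `t`;
* **`locationMask_siteTranslate`** — translating the engine's location mask (phase `c`, direction
  set `M`) by `t` gives the location mask of phase `c + φ(t)` with the same `M`;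
  `locationMask_siteTranslate_of_ker` — translations with `φ(t) = 0` preserve it (with
  `stripesPhase_apply_eq_zero`: the width sublattice).

NOT here: the `alternate` cycle's ORDER under translations; any number.
-/

namespace Summit.Ventures.LatticeQCDFlow.Exactness

open Literature.MathematicalPhysics.QuantumFieldTheory

variable {d L : ℕ}

section AnyGroup

variable {G : Type*} [Group G]

/-- Site arithmetic under translation: `(x − ν̂)·μ̂-shift + t = ((x + t) − ν̂)·μ̂-shift`. -/
private theorem shift_sub_single_add (x t : Site d L) (μ ν : Fin d) :
    (x - Pi.single ν 1).shift μ + t = (x + t - Pi.single ν 1).shift μ := by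
  simp only [Site.shift]
  abel

/-- Site arithmetic under translation: `(x − ν̂) + t = (x + t) − ν̂`. -/
private theorem sub_single_add (x t : Site d L) (ν : Fin d) :
    x - Pi.single ν 1 + t = x + t - Pi.single ν 1 := by
  abel

/-- **The behind loop translates**: for a `t`-periodic plane choice, the behind loop of `V·t` at
`e = (x, μ)` is the behind loop of `V` at `(x + t, μ)`. -/
theorem behindLoop_siteTranslate (t : Site d L) (ν : Edge d L → Fin d)
    (hν : ∀ e : Edge d L, ν (e.1 + t, e.2) = ν e) (V : GaugeConfig d L G) (e : Edge d L) :
    GaugeConfig.siteTranslate t V e *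
        ((GaugeConfig.siteTranslate t V ((e.1 - Pi.single (ν e) 1).shift e.2, ν e))⁻¹ *
          (GaugeConfig.siteTranslate t V (e.1 - Pi.single (ν e) 1, e.2))⁻¹ *
          GaugeConfig.siteTranslate t V (e.1 - Pi.single (ν e) 1, ν e)) =
      V (e.1 + t, e.2) *
        ((V (((e.1 + t, e.2).1 - Pi.single (ν (e.1 + t, e.2)) 1).shift (e.1 + t, e.2).2, ν (e.1 + t, e.2)))⁻¹ *
          (V ((e.1 + t, e.2).1 - Pi.single (ν (e.1 + t, e.2)) 1, (e.1 + t, e.2).2))⁻¹ *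
          V ((e.1 + t, e.2).1 - Pi.single (ν (e.1 + t, e.2)) 1, ν (e.1 + t, e.2))) := by
  simp only [GaugeConfig.siteTranslate_apply, hν, shift_sub_single_add, sub_single_add]

/-- **The behind-plaquette kernel coupling layer intertwines lattice translations** (any group;
masks related by `p e ↔ p' (e + t)`, plane choice `t`-periodic, kernel data translation covariant
on active links). -/
theorem behindPlaquetteKernelLayer_siteTranslate (p p' : Edge d L → Prop) [DecidablePred p] [DecidablePred p']
    (t : Site d L) (ν : Edge d L → Fin d) (hν : ∀ e : Edge d L, ν (e.1 + t, e.2) = ν e)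
    (h : GaugeConfig d L G → Edge d L → G → G)
    (hp : ∀ e : Edge d L, p e ↔ p' (e.1 + t, e.2))
    (hh : ∀ (V : GaugeConfig d L G) (e : Edge d L), p e →
      h (GaugeConfig.siteTranslate t V) e = h V (e.1 + t, e.2))
    (V : GaugeConfig d L G) :
    (fun e : Edge d L =>
        if p e then
          h (GaugeConfig.siteTranslate t V) e
              (GaugeConfig.siteTranslate t V e *
                ((GaugeConfig.siteTranslate t V ((e.1 - Pi.single (ν e) 1).shift e.2, ν e))⁻¹ *
                  (GaugeConfig.siteTranslate t V (e.1 - Pi.single (ν e) 1, e.2))⁻¹ *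
                  GaugeConfig.siteTranslate t V (e.1 - Pi.single (ν e) 1, ν e))) *
            (GaugeConfig.siteTranslate t V e *
                ((GaugeConfig.siteTranslate t V ((e.1 - Pi.single (ν e) 1).shift e.2, ν e))⁻¹ *
                  (GaugeConfig.siteTranslate t V (e.1 - Pi.single (ν e) 1, e.2))⁻¹ *
                  GaugeConfig.siteTranslate t V (e.1 - Pi.single (ν e) 1, ν e)))⁻¹ *
              GaugeConfig.siteTranslate t V e
        else GaugeConfig.siteTranslate t V e) =
      GaugeConfig.siteTranslate t (fun e : Edge d L =>
        if p' e then
          h V e (V e * ((V ((e.1 - Pi.single (ν e) 1).shift e.2, ν e))⁻¹ * (V (e.1 - Pi.single (ν e) 1, e.2))⁻¹ *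
              V (e.1 - Pi.single (ν e) 1, ν e))) *
            (V e * ((V ((e.1 - Pi.single (ν e) 1).shift e.2, ν e))⁻¹ * (V (e.1 - Pi.single (ν e) 1, e.2))⁻¹ *
              V (e.1 - Pi.single (ν e) 1, ν e)))⁻¹ * V e
        else V e) := by
  funext e
  simp only [GaugeConfig.siteTranslate_apply]
  by_cases he : p e
  · rw [if_pos he, if_pos ((hp e).1 he), hh V e he]
    simp only [hν, shift_sub_single_add, sub_single_add]
  · rw [if_neg he, if_neg (fun he' => he ((hp e).2 he'))]

/-- **A mask-preserving translation commutes with the behind-plaquette layer**: `F (V·t) = (F V)·t`. -/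
theorem behindPlaquetteKernelLayer_siteTranslate_of_invariant_mask (p : Edge d L → Prop) [DecidablePred p]
    (t : Site d L) (ν : Edge d L → Fin d) (hν : ∀ e : Edge d L, ν (e.1 + t, e.2) = ν e)
    (h : GaugeConfig d L G → Edge d L → G → G)
    (hp : ∀ e : Edge d L, p e ↔ p (e.1 + t, e.2))
    (hh : ∀ (V : GaugeConfig d L G) (e : Edge d L), p e →
      h (GaugeConfig.siteTranslate t V) e = h V (e.1 + t, e.2))
    (V : GaugeConfig d L G) :
    (fun e : Edge d L =>
        if p e then
          h (GaugeConfig.siteTranslate t V) e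
              (GaugeConfig.siteTranslate t V e *
                ((GaugeConfig.siteTranslate t V ((e.1 - Pi.single (ν e) 1).shift e.2, ν e))⁻¹ *
                  (GaugeConfig.siteTranslate t V (e.1 - Pi.single (ν e) 1, e.2))⁻¹ *
                  GaugeConfig.siteTranslate t V (e.1 - Pi.single (ν e) 1, ν e))) *
            (GaugeConfig.siteTranslate t V e *
                ((GaugeConfig.siteTranslate t V ((e.1 - Pi.single (ν e) 1).shift e.2, ν e))⁻¹ *
                  (GaugeConfig.siteTranslate t V (e.1 - Pi.single (ν e) 1, e.2))⁻¹ *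
                  GaugeConfig.siteTranslate t V (e.1 - Pi.single (ν e) 1, ν e)))⁻¹ *
              GaugeConfig.siteTranslate t V e
        else GaugeConfig.siteTranslate t V e) =
      GaugeConfig.siteTranslate t (fun e : Edge d L =>
        if p e then
          h V e (V e * ((V ((e.1 - Pi.single (ν e) 1).shift e.2, ν e))⁻¹ * (V (e.1 - Pi.single (ν e) 1, e.2))⁻¹ *
              V (e.1 - Pi.single (ν e) 1, ν e))) *
            (V e * ((V ((e.1 - Pi.single (ν e) 1).shift e.2, ν e))⁻¹ * (V (e.1 - Pi.single (ν e) 1, e.2))⁻¹ *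
              V (e.1 - Pi.single (ν e) 1, ν e)))⁻¹ * V e
        else V e) :=
  behindPlaquetteKernelLayer_siteTranslate p p t ν hν h hp hh V

end AnyGroup

/-! ## The engine's location masks under translations -/

section Masks

variable {A : Type*} [AddGroup A]

/-- **Translating a location mask shifts its phase by `φ(t)`** (direction set `M` unchanged): `e`
is active for phase `c` iff `e + t` is active for phase `c + φ(t)`. -/
theorem locationMask_siteTranslate (φ : (Fin d → ZMod L) →+ A) (c : A) (M : Set (Fin d)) (t : Site d L)
    (e : Edge d L) :
    (φ e.1 = c ∧ e.2 ∈ M) ↔ (φ (e.1 + t, e.2).1 = c + φ t ∧ (e.1 + t, e.2).2 ∈ M) := by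
  show (φ e.1 = c ∧ e.2 ∈ M) ↔ (φ (e.1 + t) = c + φ t ∧ e.2 ∈ M)
  rw [map_add, add_left_inj]

/-- **Translations in the kernel of the phase preserve every location mask.** -/
theorem locationMask_siteTranslate_of_ker (φ : (Fin d → ZMod L) →+ A) (c : A) (M : Set (Fin d))
    {t : Site d L} (ht : φ t = 0) (e : Edge d L) :
    (φ e.1 = c ∧ e.2 ∈ M) ↔ (φ (e.1 + t, e.2).1 = c ∧ (e.1 + t, e.2).2 ∈ M) := by
  have h := locationMask_siteTranslate φ c M t e
  rwa [ht, add_zero] at h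

end Masks

end Summit.Ventures.LatticeQCDFlow.Exactness
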